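import Summits.QuantumFields.YangMills.Theorems.ComplexCouplingChannelContinuumLegGivenGapArraysChessboard
import Summits.QuantumFields.YangMills.Theorems.OneCertifiedCubeContinuumLimitExistsOfStubs

/-!
# `ContinuumLimitExists` (stmt-QuantumFields-16124), line `birth`: the UV clause of the ∃-stub through the chessboard

Glue for the constructive ∃-stub `stub_uvBounds` of the registered skeleton `Cruxes/ContinuumLimitExists/Lines/birth.lean`
(v5: `∀ G compact simple, ∃ r sch, sch.HasWeakCouplingLimit ∧ PolyVolumeGrowth sch ∧ UUVB r sch ∧ ND2 r sch ∧ ND3 r sch`).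
Its only MANY-BODY clause is `UUVB r sch` — `k`-uniform E0′ bounds for the canonical distributions of ALL plaquette strings of
ALL arities on ALL off-diagonal test functions.  Because the crux is existential in the scheme, the scheme's tori may be taken
TRIADIC (`2L_k+1 = 3^M`), and on triadic tori the Fröhlich–Israel–Lieb–Simon chessboard estimate for smeared plaquette fields in
the cores of an alternating site/link-wall grid — LANDED for this tree's Wilson measure by the sibling chain of crux
stmt-QuantumFields-15828 (`ContinuumLegGivenGap.arrays_chessboard`, p162501; line `alternating-curvature-arrays`) — bounds every
such many-body quantity by a product of ONE-BODY array exponents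
`arrayRoot r β a L m v z₀ q f = ⟨∏_{all cells} mirror copies of Φ_q(f)⟩^{1/#cells}`.

Hence (this file, sorry-free):

* `productBound_of_arrayExponent` — a `k`-uniform one-body bound `arrayRoot ≤ C · max(ℓ, ℓ⁻¹)^p · cellNorm s ℓ f`
  (`ℓ = a_k 3^m / 2` the physical cell side) along the scheme's OWN tori, eventually triadic, at eventually non-negative
  coupling, gives the product bound `ProductBound r sch` of the arrays line (chessboard, factor by factor);
* `uuvb_of_arrayExponent` — with the Whitney / grid-shift step `PolyVolumeGrowth sch → ProductBound r sch → UUVB r sch`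
  (VERBATIM the statement `stub_productToUniform` of 15828's registered skeleton, pure lattice analysis being proved there by its
  pieces `stub_ptu*`; taken here as an explicit hypothesis `hPTU`, never restated as a definition) this is `UUVB r sch`;
* `uvBounds_of_arrayExponent` — the v5 ∃-stub STATEMENT of `birth` from `hPTU` and the ONE-BODY ∃-statement
  `∃ r sch, weak ∧ PVG ∧ (eventually triadic) ∧ (CB along sch) ∧ ND2 ∧ ND3` (the prospective v6 ∃-stub `stub_cbBounds`);
* `continuumLimitExists_of_cbStubs` — the crux BY NAME from `hPTU`, that one-body ∃-statement and the two registered ∀-stub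
  statements (`stub_rotation345`, `stub_coreClustering`), through the landed v5 composition `continuumLimitExists_of_birthStubs`
  (p160494).

What this changes for the crux's residue (numbers, not adjectives): the UV half of the constructive leg is no longer an
E0′ bound for every arity `p`, every plaquette string and every test function with `(p!)^β` growth, but ONE bound per cell scale
on ONE maximally symmetric one-body configuration (a free energy per cell of a periodic mirror array of one smeared, canonically
normalised, exactly centred plaquette field), factorial-free in the cell count, along ONE weak-coupling sequence of our choosing
— the gap-free, existential shadow of 15828's bet (CB) `stub_arrayExponent` (there stated at the gap-pinned unit and volume-
uniformly).  It is still open (its truth content on `a ≲ ℓ ≲ 1` is UV stability with one composite insertion per cell,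
Bałaban-class), and `ND2 ∧ ND3` (non-triviality / non-Gaussianity floors at the same unit) are untouched.

No new definitions (the one-body bound is written out); no `sorry`; axioms standard.
-/

set_option autoImplicit false

noncomputable section

namespace Summit.QuantumFields.YangMills.Cruxes.ContinuumLimitExists.Birth

open scoped SchwartzMap
open Filter Topology MeasureTheory
open Literature.MathematicalPhysics.QuantumFieldTheory Literature.MathematicalPhysics.QuantumLattice
  Literature.MathematicalPhysics.AQFT Literature.Probability.LatticeModels
open Summit.QuantumFields.YangMills.Cruxes.ContinuumLimitOnTrajectory.TwoOrbitSynchronisation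
open Summit.QuantumFields.YangMills.Theorems.ContinuumLegGivenGap (arrays_chessboard)
open Summit.QuantumFields.YangMills.Theorems.ContinuumLegGivenGap.AlternatingArrays

section OneBody

variable {G : Type} [Group G] [TopologicalSpace G] [IsTopologicalGroup G] [CompactSpace G]
  [MeasurableSpace G] [BorelSpace G]

/-- **(CB along the scheme) ∧ chessboard ⇒ (PB).**  If the scheme's couplings are eventually non-negative and its tori
eventually triadic, a `k`-uniform bound on the one-body array exponents of the scheme's OWN tori,
`arrayRoot r β_k a_k L_k m v z₀ q f ≤ C · max(ℓ, ℓ⁻¹)^p · cellNorm s ℓ f` (`ℓ = a_k · 3^m/2`; all admissible levels `m`,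
grid offsets `v`, home cells `z₀` in the central half-box, orientations `q`, real `f` supported in the core), gives the product
bound `ProductBound r sch`: the landed chessboard estimate `arrays_chessboard` bounds the canonical distribution of a tensor of
core-supported fields in distinct cells by the product of their array exponents, each of which is bounded by hypothesis.
(The scheme-pinned, volume-uniform version is `ContinuumLegGivenGap.arrays_productBound_of_exponent`.) [folklore]
[cite: FrohlichIsraelLiebSimon1978, Thm 2.2] -/
theorem productBound_of_arrayExponent (r : LatticeRep G) (sch : SpeciesScheme (YMSpecies G))
    (hβ : ∀ᶠ k in atTop, 0 ≤ sch.β k) (hT : ∀ᶠ k in atTop, IsTriadic (sch.L k))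
    {C : ℝ} {p s k₀ : ℕ} (hC : 0 ≤ C)
    (hCB : ∀ k : ℕ, k₀ ≤ k → ∀ (m : ℕ) (v z₀ : Fin 4 → ℤ) (q : PlaqIdx) (f : 𝓢(EuclideanSpace ℝ (Fin 4), ℝ)),
      LevelAdmissible (sch.L k) m → CellInHalfBox (sch.L k) m v z₀ → tsupport f ⊆ physCore (sch.a k) m v z₀ →
      arrayRoot r (sch.β k) (sch.a k) (sch.L k) m v z₀ q f ≤
        C * max (sch.a k * cellSide m) (sch.a k * cellSide m)⁻¹ ^ p * cellNorm s (sch.a k * cellSide m) f) :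
    ProductBound r sch := by
  obtain ⟨k₁, hk₁⟩ := (hβ.and hT).exists_forall_of_atTop
  refine ⟨C, p, s, max k₀ k₁, hC, fun k hk => ⟨(hk₁ k ((le_max_right _ _).trans hk)).2, ?_⟩⟩
  intro n m v q z f F hm hbox hz hf hF
  have hk₀ : k₀ ≤ k := (le_max_left _ _).trans hk
  have hβk : 0 ≤ sch.β k := (hk₁ k ((le_max_right _ _).trans hk)).1
  obtain ⟨hnn, hle⟩ := arrays_chessboard G r sch k m hβk hm v n q z f F hbox hz hf hF
  refine hle.trans (Finset.prod_le_prod (fun i _ => ?_) fun i _ => ?_)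
  · unfold arrayRoot
    exact Real.rpow_nonneg (hnn i) _
  · exact hCB k hk₀ m v (z i) (q i) (f i) hm (hbox i) (hf i)

/-- **(CB along the scheme) ∧ chessboard ∧ (PTU) ⇒ (UUVB)** at weak coupling with polynomial volume growth: the uniform-threshold
E0′ bounds for all plaquette strings from the one-body array exponent bound, given the Whitney / grid-shift step
`PolyVolumeGrowth sch → ProductBound r sch → UUVB r sch` (hypothesis `hPTU`, verbatim 15828's `stub_productToUniform`). [folklore] -/
theorem uuvb_of_arrayExponent
    (hPTU : ∀ (G : Type) [Group G] [TopologicalSpace G] [IsTopologicalGroup G] [CompactSpace G]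
      [MeasurableSpace G] [BorelSpace G] (r : LatticeRep G) (sch : SpeciesScheme (YMSpecies G)),
      PolyVolumeGrowth sch → ProductBound r sch → UUVB r sch)
    (r : LatticeRep G) (sch : SpeciesScheme (YMSpecies G))
    (hW : sch.HasWeakCouplingLimit) (hGr : PolyVolumeGrowth sch) (hT : ∀ᶠ k in atTop, IsTriadic (sch.L k))
    {C : ℝ} {p s k₀ : ℕ} (hC : 0 ≤ C)
    (hCB : ∀ k : ℕ, k₀ ≤ k → ∀ (m : ℕ) (v z₀ : Fin 4 → ℤ) (q : PlaqIdx) (f : 𝓢(EuclideanSpace ℝ (Fin 4), ℝ)),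
      LevelAdmissible (sch.L k) m → CellInHalfBox (sch.L k) m v z₀ → tsupport f ⊆ physCore (sch.a k) m v z₀ →
      arrayRoot r (sch.β k) (sch.a k) (sch.L k) m v z₀ q f ≤
        C * max (sch.a k * cellSide m) (sch.a k * cellSide m)⁻¹ ^ p * cellNorm s (sch.a k * cellSide m) f) :
    UUVB r sch :=
  hPTU G r sch hGr (productBound_of_arrayExponent r sch (hW.eventually_ge_atTop 0) hT hC hCB)

end OneBody

/-- **The v5 ∃-stub statement of `birth` from the ONE-BODY ∃-statement (prospective v6 ∃-stub `stub_cbBounds`).**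
Given (PTU), a faithful `r` and a weak-coupling, polynomially growing, eventually triadic scheme whose one-body array exponents
obey a `k`-uniform canonical-scaling bound and whose canonical curvature two- and three-point distributions have floors give the
registered statement `∃ r sch, weak ∧ PVG ∧ UUVB ∧ ND2 ∧ ND3` (hence, by `uvScheme_of_uvBounds`, also the product-convergent v4
statement along a sub-scheme).  Registered glue anchor of stmt-QuantumFields-16124 (statement in arrow form: first
hypothesis (PTU), second the one-body ∃-statement). [folklore] -/
theorem uvBounds_of_arrayExponent :
    (∀ (G : Type) [Group G] [TopologicalSpace G] [IsTopologicalGroup G] [CompactSpace G]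
      [MeasurableSpace G] [BorelSpace G] (r : LatticeRep G) (sch : SpeciesScheme (YMSpecies G)),
      PolyVolumeGrowth sch → ProductBound r sch → UUVB r sch) →
    (∀ (G : Type) [Group G] [TopologicalSpace G] [IsTopologicalGroup G] [CompactSpace G]
      [MeasurableSpace G] [BorelSpace G], IsCompactSimpleLieGroup G →
      ∃ (r : LatticeRep G) (sch : SpeciesScheme (YMSpecies G)),
        sch.HasWeakCouplingLimit ∧ PolyVolumeGrowth sch ∧ (∀ᶠ k in atTop, IsTriadic (sch.L k)) ∧
        (∃ (C : ℝ) (p s k₀ : ℕ), 0 ≤ C ∧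
          ∀ k : ℕ, k₀ ≤ k → ∀ (m : ℕ) (v z₀ : Fin 4 → ℤ) (q : PlaqIdx)
            (f : SchwartzMap (EuclideanSpace ℝ (Fin 4)) ℝ),
            LevelAdmissible (sch.L k) m → CellInHalfBox (sch.L k) m v z₀ →
            tsupport f ⊆ physCore (sch.a k) m v z₀ →
            arrayRoot r (sch.β k) (sch.a k) (sch.L k) m v z₀ q f ≤
              C * max (sch.a k * cellSide m) (sch.a k * cellSide m)⁻¹ ^ p *
                cellNorm s (sch.a k * cellSide m) f) ∧
        ND2 r sch ∧ ND3 r sch) →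
    ∀ (G : Type) [Group G] [TopologicalSpace G] [IsTopologicalGroup G] [CompactSpace G]
      [MeasurableSpace G] [BorelSpace G], IsCompactSimpleLieGroup G →
      ∃ (r : LatticeRep G) (sch : SpeciesScheme (YMSpecies G)),
        sch.HasWeakCouplingLimit ∧ PolyVolumeGrowth sch ∧ UUVB r sch ∧ ND2 r sch ∧ ND3 r sch := by
  intro hPTU hCB G _ _ _ _ _ _ hG
  obtain ⟨r, sch, hW, hGr, hT, ⟨C, p, s, k₀, hC, hCBk⟩, hND2, hND3⟩ := hCB G hG
  exact ⟨r, sch, hW, hGr, uuvb_of_arrayExponent hPTU r sch hW hGr hT hC hCBk, hND2, hND3⟩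

/-- **The crux BY NAME from (PTU), the one-body ∃-statement and the two registered ∀-stub statements** (`stub_rotation345`,
`stub_coreClustering`, verbatim) — the prospective v6 composition of line `birth` as a tree theorem, through the landed v5
composition `continuumLimitExists_of_birthStubs` (p160494) and `uvBounds_of_arrayExponent`. [folklore] -/
theorem continuumLimitExists_of_cbStubs
    (hPTU : ∀ (G : Type) [Group G] [TopologicalSpace G] [IsTopologicalGroup G] [CompactSpace G]
      [MeasurableSpace G] [BorelSpace G] (r : LatticeRep G) (sch : SpeciesScheme (YMSpecies G)),
      PolyVolumeGrowth sch → ProductBound r sch → UUVB r sch)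
    (hCB : ∀ (G : Type) [Group G] [TopologicalSpace G] [IsTopologicalGroup G] [CompactSpace G]
      [MeasurableSpace G] [BorelSpace G], IsCompactSimpleLieGroup G →
      ∃ (r : LatticeRep G) (sch : SpeciesScheme (YMSpecies G)),
        sch.HasWeakCouplingLimit ∧ PolyVolumeGrowth sch ∧ (∀ᶠ k in atTop, IsTriadic (sch.L k)) ∧
        (∃ (C : ℝ) (p s k₀ : ℕ), 0 ≤ C ∧
          ∀ k : ℕ, k₀ ≤ k → ∀ (m : ℕ) (v z₀ : Fin 4 → ℤ) (q : PlaqIdx) (f : 𝓢(EuclideanSpace ℝ (Fin 4), ℝ)),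
            LevelAdmissible (sch.L k) m → CellInHalfBox (sch.L k) m v z₀ →
            tsupport f ⊆ physCore (sch.a k) m v z₀ →
            arrayRoot r (sch.β k) (sch.a k) (sch.L k) m v z₀ q f ≤
              C * max (sch.a k * cellSide m) (sch.a k * cellSide m)⁻¹ ^ p *
                cellNorm s (sch.a k * cellSide m) f) ∧
        ND2 r sch ∧ ND3 r sch)
    (h₂ : ∀ (G : Type) [Group G] [TopologicalSpace G] [IsTopologicalGroup G] [CompactSpace G]
      [MeasurableSpace G] [BorelSpace G], IsCompactSimpleLieGroup G →
      ∀ (r : LatticeRep G) (sch : SpeciesScheme (YMSpecies G)),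
        sch.HasWeakCouplingLimit → PolyVolumeGrowth sch → ConvProducts r sch → UUVB r sch →
          Rot345 r sch)
    (h₄ : ∀ (G : Type) [Group G] [TopologicalSpace G] [IsTopologicalGroup G] [CompactSpace G]
      [MeasurableSpace G] [BorelSpace G], IsCompactSimpleLieGroup G →
      ∀ (r : LatticeRep G) (sch : SpeciesScheme (YMSpecies G)),
        sch.HasWeakCouplingLimit → PolyVolumeGrowth sch → ConvProducts r sch → UUVB r sch →
          CoreClustering r sch) :
    Summit.QuantumFields.YangMills.Theses.OneCertifiedCube.ContinuumLimitExists :=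
  continuumLimitExists_of_birthStubs (uvBounds_of_arrayExponent hPTU hCB) h₂ h₄

end Summit.QuantumFields.YangMills.Cruxes.ContinuumLimitExists.Birth

end
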